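import Literature.Probability.RandomPlanarGeometry.LoewnerDerivRatio
import HarnessLib

/-!
# The Loewner flow of a point of `ℍ` in integrated form; the frozen imaginary part

Topic `Probability/RandomPlanarGeometry`; deterministic preliminaries (any *continuous* driving
function `W`, any starting point `z` with `0 < im z`) for the Itô calculus of Rohde–Schramm's
process `zₜ = xₜ + i yₜ = gₜ(z) - Wₜ` (Rohde–Schramm (2005), §2.1 and eq. (6.4): "`dxₜ = 2xₜ|zₜ|⁻² dt
- dξ(t)`", "`∂ₜ yₜ = -2yₜ/|zₜ|²`"), serving the discharge of Lemma 6.3 (`κ < 8`):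

* `Literature.Probability.RandomPlanarGeometry.Loewner.map_eq_add_integral` — the chordal Loewner
  equation (2.1) in integrated form along the flow of `z`: `gₜ(z) = z + ∫₀ᵗ 2/(gₛ(z) - Wₛ) ds` for
  `t < T_z` (fundamental theorem of calculus along the maximal solution), with its real and
  imaginary parts (`re_map_eq_add_integral`, `im_map_eq_add_integral`) and the equation for the
  reciprocal imaginary part `1/yₜ = 1/y₀ + ∫₀ᵗ 2/(yₛ|zₛ|²) ds` (`inv_im_map_eq_add_integral`);
* `Literature.Probability.RandomPlanarGeometry.Loewner.imFlowStop W z t` — the **frozen imaginary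
  part** `yₜ = im gₜ(z)` for `t < T_z`, set to `0` from `T_z` on; it is positive exactly before
  `T_z`, bounded by `im z`, non-increasing, and — the point of the freezing — a **continuous** path
  on all of `ℝ≥0` (`continuous_imFlowStop`): at a finite swallowing time `yₜ ↓ 0`, because the
  maximal solution comes arbitrarily close to the driving function (`IsSolution.exists_norm_sub_lt`)
  while `yₜ ≤ |zₜ|` is non-increasing.

## References

* S. Rohde, O. Schramm, *Basic properties of SLE*, Ann. of Math. 161 (2005), §2.1 (eq. (2.1),
  `τ(z)`), proof of Lemma 6.3 (p. 904) and of Lemma 6.5 (p. 907, `dxₜ`).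
* G. F. Lawler, *Conformally Invariant Processes in the Plane* (2005), Ch. 4 §4.1, eq. (4.5).
-/

noncomputable section

open Set Filter MeasureTheory Metric Complex
open _root_.Topology
open scoped NNReal

namespace Literature.Probability.RandomPlanarGeometry

namespace Loewner

variable {W : ℝ≥0 → ℝ} {z : ℂ} {g : ℝ → ℂ} {T : WithTop ℝ≥0}

/-! ### The real part of the Loewner field -/

/-- The real part of the Loewner vector field at a point `w` (real driving value `W t`):
`re (2/(w - W t)) = 2 re(w - W t) / |w - W t|²`. [folklore] -/
theorem re_vectorField (W : ℝ≥0 → ℝ) (t : ℝ) (w : ℂ) :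
    (vectorField W t w).re = 2 * (w.re - W t.toNNReal) / Complex.normSq (w - W t.toNNReal) := by
  rw [vectorField_apply, Complex.div_re]
  simp [mul_div_assoc]

/-! ### The integrated Loewner equation along the flow of a point -/

/-- **A solution in integrated form**: `g t = z + ∫₀ᵗ 2/(g s - W s) ds` for `t` in the lifetime
(fundamental theorem of calculus: `g` is continuous on `[0, t]` and differentiable on `(0, t)`
with the continuous derivative `2/(g s - W s)`). Rohde–Schramm (2005), eq. (2.1).
[cite: RohdeSchramm2005, §2.1] -/
theorem IsSolution.eq_add_integral (hW : Continuous W) (hg : IsSolution W z g T) {t : ℝ≥0}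
    (ht : (t : WithTop ℝ≥0) < T) :
    g t = z + ∫ s in (0 : ℝ)..t, vectorField W s (g s) := by
  have ht' : (((t : ℝ).toNNReal : ℝ≥0) : WithTop ℝ≥0) < T := by simpa using ht
  have hsub := Icc_subset_timeDomain ht'
  have hcont : ContinuousOn g (Icc 0 t) := hg.continuousOn.mono hsub
  have hderiv : ∀ s ∈ Ioo (0 : ℝ) t, HasDerivAt g (vectorField W s (g s)) s := fun s hs ↦
    hg.hasDerivAt hs.1 (hsub ⟨hs.1.le, hs.2.le⟩).2
  obtain ⟨δ, hδ, hfar⟩ := hg.exists_le_norm_sub hW t.coe_nonneg ht'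
  have hδ' : (0 : ℝ) < δ := hδ
  have hne : ∀ s ∈ Icc (0 : ℝ) t, g s - W s.toNNReal ≠ 0 := fun s hs ↦
    norm_pos_iff.1 (hδ'.trans_le (hfar s hs))
  have hcont' : ContinuousOn (fun s ↦ vectorField W s (g s)) (Icc 0 t) := by
    simp only [vectorField_apply]
    exact continuousOn_const.div (hcont.sub
      ((continuous_ofReal.comp (hW.comp continuous_real_toNNReal)).continuousOn)) hne
  have hFTC := intervalIntegral.integral_eq_sub_of_hasDerivAt_of_le (NNReal.coe_nonneg t) hcont
    hderiv (hcont'.intervalIntegrable_of_Icc (NNReal.coe_nonneg t))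
  rw [hFTC, hg.apply_zero]
  ring

/-- **The Loewner map in integrated form**: for `z ≠ W₀` and `t < T_z`,
`map W t z = z + ∫₀ᵗ 2/(map W s z - W s) ds`. Rohde–Schramm (2005), eq. (2.1).
[cite: RohdeSchramm2005, §2.1] -/
theorem map_eq_add_integral (hW : Continuous W) {t : ℝ≥0}
    (ht : (t : WithTop ℝ≥0) < swallowingTime W z) :
    map W t z = z + ∫ s in (0 : ℝ)..t, vectorField W s (map W s.toNNReal z) := by
  obtain ⟨g, hg⟩ := exists_isSolution_swallowingTime_holds hW (ne_driving_of_lt_swallowingTime ht)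
  rw [map_eq_of_isSolution hW hg ht, hg.eq_add_integral hW ht]
  congr 1
  refine intervalIntegral.integral_congr fun s hs ↦ ?_
  rw [uIcc_of_le (NNReal.coe_nonneg t)] at hs
  have hsT : ((s.toNNReal : ℝ≥0) : WithTop ℝ≥0) < swallowingTime W z :=
    lt_of_le_of_lt (WithTop.coe_le_coe.2 (Real.toNNReal_le_iff_le_coe.2 hs.2)) ht
  simp only [map_eq_of_isSolution hW hg hsT, Real.coe_toNNReal _ hs.1]

/-- The integrand of the integrated Loewner equation is continuous on `[0, t]` (`t < T_z`).
[folklore] -/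
theorem continuousOn_vectorField_map (hW : Continuous W) {t : ℝ≥0}
    (ht : (t : WithTop ℝ≥0) < swallowingTime W z) :
    ContinuousOn (fun s : ℝ ↦ vectorField W s (map W s.toNNReal z)) (Icc 0 t) := by
  obtain ⟨g, hg⟩ := exists_isSolution_swallowingTime_holds hW (ne_driving_of_lt_swallowingTime ht)
  have ht' : (((t : ℝ).toNNReal : ℝ≥0) : WithTop ℝ≥0) < swallowingTime W z := by simpa using ht
  have hsub := Icc_subset_timeDomain ht'
  obtain ⟨δ, hδ, hfar⟩ := hg.exists_le_norm_sub hW t.coe_nonneg ht'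
  have hδ' : (0 : ℝ) < δ := hδ
  have hne : ∀ s ∈ Icc (0 : ℝ) t, g s - W s.toNNReal ≠ 0 := fun s hs ↦
    norm_pos_iff.1 (hδ'.trans_le (hfar s hs))
  have hcont : ContinuousOn (fun s ↦ vectorField W s (g s)) (Icc 0 t) := by
    simp only [vectorField_apply]
    exact continuousOn_const.div ((hg.continuousOn.mono hsub).sub
      ((continuous_ofReal.comp (hW.comp continuous_real_toNNReal)).continuousOn)) hne
  refine hcont.congr fun s hs ↦ ?_
  have hsT : ((s.toNNReal : ℝ≥0) : WithTop ℝ≥0) < swallowingTime W z := (hsub hs).2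
  simp only [map_eq_of_isSolution hW hg hsT, Real.coe_toNNReal _ hs.1]

/-- **Real part of the flow**: `re gₜ(z) = re z + ∫₀ᵗ 2 re(gₛ(z) - Wₛ)/|gₛ(z) - Wₛ|² ds` for
`t < T_z`. Rohde–Schramm (2005), proof of Lemma 6.5 ("`dxₜ = 2xₜ|zₜ|⁻² dt - dξ(t)`", p. 907).
[cite: RohdeSchramm2005, Lemma 6.5 (proof)] -/
theorem re_map_eq_add_integral (hW : Continuous W) {t : ℝ≥0}
    (ht : (t : WithTop ℝ≥0) < swallowingTime W z) :
    (map W t z).re = z.re + ∫ s in (0 : ℝ)..t,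
      2 * ((map W s.toNNReal z).re - W s.toNNReal) /
        Complex.normSq (map W s.toNNReal z - W s.toNNReal) := by
  have h := congrArg Complex.re (map_eq_add_integral hW ht)
  rw [Complex.add_re] at h
  rw [h]
  congr 1
  have hint : IntervalIntegrable (fun s : ℝ ↦ vectorField W s (map W s.toNNReal z)) volume 0 t :=
    (continuousOn_vectorField_map hW ht).intervalIntegrable_of_Icc (NNReal.coe_nonneg t)
  rw [← Complex.reCLM_apply, ← ContinuousLinearMap.intervalIntegral_comp_comm _ hint]
  refine intervalIntegral.integral_congr fun s _ ↦ ?_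
  simp only [Complex.reCLM_apply, re_vectorField]

/-- **Imaginary part of the flow**: `im gₜ(z) = im z + ∫₀ᵗ (-2 im gₛ(z)/|gₛ(z) - Wₛ|²) ds` for
`t < T_z`. Rohde–Schramm (2005), proof of Lemma 6.3 (`∂ₜ log yₜ = -2/|zₜ|²`, p. 904);
Lawler (2005), eq. (4.5). [cite: RohdeSchramm2005, Lemma 6.3 (proof)] -/
theorem im_map_eq_add_integral (hW : Continuous W) {t : ℝ≥0}
    (ht : (t : WithTop ℝ≥0) < swallowingTime W z) :
    (map W t z).im = z.im + ∫ s in (0 : ℝ)..t,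
      -2 * (map W s.toNNReal z).im / Complex.normSq (map W s.toNNReal z - W s.toNNReal) := by
  have h := congrArg Complex.im (map_eq_add_integral hW ht)
  rw [Complex.add_im] at h
  rw [h]
  congr 1
  have hint : IntervalIntegrable (fun s : ℝ ↦ vectorField W s (map W s.toNNReal z)) volume 0 t :=
    (continuousOn_vectorField_map hW ht).intervalIntegrable_of_Icc (NNReal.coe_nonneg t)
  rw [← Complex.imCLM_apply, ← ContinuousLinearMap.intervalIntegral_comp_comm _ hint]
  refine intervalIntegral.integral_congr fun s _ ↦ ?_
  simp only [Complex.imCLM_apply, im_vectorField]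

/-- The flow of a point is continuous in time on `{t | t < T_z}`. [folklore] -/
theorem continuousOn_map_left (hW : Continuous W) (hz : z ≠ W 0) :
    ContinuousOn (fun s : ℝ≥0 ↦ map W s z) {s | (s : WithTop ℝ≥0) < swallowingTime W z} := by
  obtain ⟨g, hg⟩ := exists_isSolution_swallowingTime_holds hW hz
  have hmaps : MapsTo (fun s : ℝ≥0 ↦ (s : ℝ)) {s | (s : WithTop ℝ≥0) < swallowingTime W z}
      {t : ℝ | 0 ≤ t ∧ (t.toNNReal : WithTop ℝ≥0) < swallowingTime W z} :=
    fun s hs ↦ ⟨s.coe_nonneg, by simpa using hs⟩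
  have h1 : ContinuousOn (fun s : ℝ≥0 ↦ g s) {s | (s : WithTop ℝ≥0) < swallowingTime W z} :=
    hg.continuousOn.comp NNReal.continuous_coe.continuousOn hmaps
  exact h1.congr fun s hs ↦ map_eq_of_isSolution hW hg hs

/-- The imaginary part of the flow of a point of `ℍ` is positive before `T_z`. [folklore] -/
theorem im_map_pos_of_lt (hW : Continuous W) (hz : 0 < z.im) {t : ℝ≥0}
    (ht : (t : WithTop ℝ≥0) < swallowingTime W z) : 0 < (map W t z).im :=
  mapsTo_map hW t ((mem_domain_iff W t z).2 ⟨hz, ht⟩)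

/-- The imaginary part of the flow of a point of `ℍ` is non-increasing before `T_z`:
`im gₜ(z) ≤ im gₛ(z)` for `s ≤ t < T_z`. Lawler (2005), eq. (4.5). [cite: Lawler2005, Ch. 4 §4.1] -/
theorem im_map_le_im_map (hW : Continuous W) (hz : 0 < z.im) {s t : ℝ≥0} (hst : s ≤ t)
    (ht : (t : WithTop ℝ≥0) < swallowingTime W z) : (map W t z).im ≤ (map W s z).im := by
  obtain ⟨g, hg⟩ := exists_isSolution_swallowingTime_holds hW (ne_driving_of_lt_swallowingTime ht)
  have hs : (s : WithTop ℝ≥0) < swallowingTime W z := lt_of_le_of_lt (WithTop.coe_le_coe.2 hst) ht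
  rw [map_eq_of_isSolution hW hg ht, map_eq_of_isSolution hW hg hs]
  exact hg.im_antitoneOn hW hz ⟨s.coe_nonneg, toNNReal_coe_lt hs⟩ ⟨t.coe_nonneg, toNNReal_coe_lt ht⟩
    (NNReal.coe_le_coe.2 hst)

/-- **Reciprocal imaginary part of the flow**: `1/im gₜ(z) = 1/im z + ∫₀ᵗ 2/(im gₛ(z) |gₛ(z) - Wₛ|²) ds`
for `0 < im z` and `t < T_z` (chain rule for `y ↦ 1/y` along `ẏ = -2y/|z|²`). Rohde–Schramm
(2005), proof of Lemma 6.3, p. 904. [cite: RohdeSchramm2005, Lemma 6.3 (proof)] -/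
theorem inv_im_map_eq_add_integral (hW : Continuous W) (hz : 0 < z.im) {t : ℝ≥0}
    (ht : (t : WithTop ℝ≥0) < swallowingTime W z) :
    ((map W t z).im)⁻¹ = (z.im)⁻¹ + ∫ s in (0 : ℝ)..t,
      2 / ((map W s.toNNReal z).im * Complex.normSq (map W s.toNNReal z - W s.toNNReal)) := by
  obtain ⟨g, hg⟩ := exists_isSolution_swallowingTime_holds hW (ne_driving_of_lt_swallowingTime ht)
  have ht' : (((t : ℝ).toNNReal : ℝ≥0) : WithTop ℝ≥0) < swallowingTime W z := by simpa using ht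
  have hsub := Icc_subset_timeDomain ht'
  have hpos : ∀ s ∈ Icc (0 : ℝ) t, 0 < (g s).im := fun s hs ↦
    IsSolution.im_pos_holds hW hg hz s hs.1 (hsub hs).2
  obtain ⟨δ, hδ, hfar⟩ := hg.exists_le_norm_sub hW t.coe_nonneg ht'
  have hδ' : (0 : ℝ) < δ := hδ
  have hne : ∀ s ∈ Icc (0 : ℝ) t, g s - W s.toNNReal ≠ 0 := fun s hs ↦
    norm_pos_iff.1 (hδ'.trans_le (hfar s hs))
  -- `F s = 1 / im (g s)` and its derivative `F'`
  have hgim : ContinuousOn (fun s ↦ (g s).im) (Icc 0 t) :=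
    continuous_im.comp_continuousOn (hg.continuousOn.mono hsub)
  have hcont : ContinuousOn (fun s ↦ ((g s).im)⁻¹) (Icc 0 t) := hgim.inv₀ fun s hs ↦ (hpos s hs).ne'
  have hderiv : ∀ s ∈ Ioo (0 : ℝ) t, HasDerivAt (fun u ↦ ((g u).im)⁻¹)
      (2 / ((g s).im * Complex.normSq (g s - W s.toNNReal))) s := by
    intro s hs
    have hsI : s ∈ Icc (0 : ℝ) t := ⟨hs.1.le, hs.2.le⟩
    have h1 : HasDerivAt (fun u ↦ (g u).im) (vectorField W s (g s)).im s :=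
      imCLM.hasFDerivAt.comp_hasDerivAt s (hg.hasDerivAt hs.1 (hsub hsI).2)
    have h2 := h1.inv (hpos s hsI).ne'
    have hy : (g s).im ≠ 0 := (hpos s hsI).ne'
    have hN : Complex.normSq (g s - W s.toNNReal) ≠ 0 := (Complex.normSq_pos.2 (hne s hsI)).ne'
    have heq : -(vectorField W s (g s)).im / (g s).im ^ 2 =
        2 / ((g s).im * Complex.normSq (g s - W s.toNNReal)) := by
      rw [im_vectorField]
      field_simp
    rw [heq] at h2
    exact h2
  have hcont' : ContinuousOn (fun s ↦ 2 / ((g s).im * Complex.normSq (g s - W s.toNNReal)))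
      (Icc 0 t) := by
    refine continuousOn_const.div (hgim.mul ?_) fun s hs ↦
      mul_ne_zero (hpos s hs).ne' (Complex.normSq_pos.2 (hne s hs)).ne'
    exact Complex.continuous_normSq.comp_continuousOn ((hg.continuousOn.mono hsub).sub
      ((continuous_ofReal.comp (hW.comp continuous_real_toNNReal)).continuousOn))
  have hFTC := intervalIntegral.integral_eq_sub_of_hasDerivAt_of_le (NNReal.coe_nonneg t) hcont
    hderiv (hcont'.intervalIntegrable_of_Icc (NNReal.coe_nonneg t))
  -- identify the integrand along `map`
  have hcongr : (∫ s in (0 : ℝ)..t,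
      2 / ((map W s.toNNReal z).im * Complex.normSq (map W s.toNNReal z - W s.toNNReal))) =
      ∫ s in (0 : ℝ)..t, 2 / ((g s).im * Complex.normSq (g s - W s.toNNReal)) := by
    refine intervalIntegral.integral_congr fun s hs ↦ ?_
    rw [uIcc_of_le (NNReal.coe_nonneg t)] at hs
    have hsT : ((s.toNNReal : ℝ≥0) : WithTop ℝ≥0) < swallowingTime W z := (hsub hs).2
    simp only [map_eq_of_isSolution hW hg hsT, Real.coe_toNNReal _ hs.1]
  rw [hcongr, hFTC, map_eq_of_isSolution hW hg ht]
  simp only [hg.apply_zero]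
  ring

/-! ### The frozen imaginary part -/

variable (W z) in
/-- The **frozen imaginary part** of the flow of `z`: `imFlowStop W z t = im gₜ(z)` for `t < T_z`,
and `0` from the swallowing time `T_z` on (for continuous `W` and `im z > 0` this is the continuous
extension: `im gₜ(z) ↓ 0` as `t ↑ T_z < ∞`). Rohde–Schramm (2005), proof of Lemma 6.3 (`yₜ`,
"`τ(ẑ)` is a.s. the time at which `u = log yₜ` hits `-∞`", p. 904). [cite: RohdeSchramm2005, Lemma 6.3 (proof)] -/
def imFlowStop (t : ℝ≥0) : ℝ :=
  if (t : WithTop ℝ≥0) < swallowingTime W z then (map W t z).im else 0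

/-- Before the swallowing time the frozen imaginary part is `im gₜ(z)`. [folklore] -/
theorem imFlowStop_of_lt {t : ℝ≥0} (ht : (t : WithTop ℝ≥0) < swallowingTime W z) :
    imFlowStop W z t = (map W t z).im := if_pos ht

/-- From the swallowing time on the frozen imaginary part is `0`. [folklore] -/
theorem imFlowStop_of_not_lt {t : ℝ≥0} (ht : ¬ (t : WithTop ℝ≥0) < swallowingTime W z) :
    imFlowStop W z t = 0 := if_neg ht

/-- The frozen imaginary part is positive exactly before the swallowing time (`im z > 0`).
[folklore] -/
theorem imFlowStop_pos_iff (hW : Continuous W) (hz : 0 < z.im) {t : ℝ≥0} :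
    0 < imFlowStop W z t ↔ (t : WithTop ℝ≥0) < swallowingTime W z := by
  constructor
  · intro h
    by_contra hle
    rw [imFlowStop_of_not_lt hle] at h
    exact lt_irrefl _ h
  · intro h
    rw [imFlowStop_of_lt h]
    exact im_map_pos_of_lt hW hz h

/-- The frozen imaginary part is non-negative (`im z > 0`). [folklore] -/
theorem imFlowStop_nonneg (hW : Continuous W) (hz : 0 < z.im) (t : ℝ≥0) : 0 ≤ imFlowStop W z t := by
  by_cases h : (t : WithTop ℝ≥0) < swallowingTime W z
  · exact ((imFlowStop_pos_iff hW hz).2 h).le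
  · rw [imFlowStop_of_not_lt h]

/-- The frozen imaginary part starts at `im z` (`im z > 0`). [folklore] -/
theorem imFlowStop_zero (hW : Continuous W) (hz : 0 < z.im) : imFlowStop W z 0 = z.im := by
  have hz0 : z ≠ W 0 := by
    intro h; rw [h, ofReal_im] at hz; exact lt_irrefl _ hz
  rw [imFlowStop_of_lt (by exact_mod_cast swallowingTime_pos_holds hW hz0), map_zero_apply hW hz0]

/-- The frozen imaginary part is non-increasing (`im z > 0`). [folklore] -/
theorem imFlowStop_antitone (hW : Continuous W) (hz : 0 < z.im) : Antitone (imFlowStop W z) := by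
  intro s t hst
  by_cases ht : (t : WithTop ℝ≥0) < swallowingTime W z
  · have hs : (s : WithTop ℝ≥0) < swallowingTime W z := lt_of_le_of_lt (WithTop.coe_le_coe.2 hst) ht
    rw [imFlowStop_of_lt ht, imFlowStop_of_lt hs]
    exact im_map_le_im_map hW hz hst ht
  · rw [imFlowStop_of_not_lt ht]
    exact imFlowStop_nonneg hW hz s

/-- The frozen imaginary part is bounded by `im z` (`im z > 0`). [folklore] -/
theorem imFlowStop_le (hW : Continuous W) (hz : 0 < z.im) (t : ℝ≥0) : imFlowStop W z t ≤ z.im := by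
  have h0t : (0 : ℝ≥0) ≤ t := bot_le
  have := imFlowStop_antitone hW hz h0t
  rwa [imFlowStop_zero hW hz] at this

/-- The frozen imaginary part is dominated by the distance to the driving function before `T_z`:
`im gₜ(z) ≤ |gₜ(z) - Wₜ|`. [folklore] -/
theorem imFlowStop_le_norm_sub {t : ℝ≥0} (ht : (t : WithTop ℝ≥0) < swallowingTime W z) :
    imFlowStop W z t ≤ ‖map W t z - W t‖ := by
  rw [imFlowStop_of_lt ht]
  have h := Complex.abs_im_le_norm (map W t z - W t)
  rw [sub_im, ofReal_im, sub_zero] at h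
  exact (le_abs_self _).trans h

/-- **The swallowed point's imaginary part tends to `0`**: if `im z > 0` and `T_z = b < ∞`, then
for every `ε > 0` there is `s < b` with `im gₜ(z) < ε` for all `t ∈ [s, b)`: the maximal solution
comes within `ε` of the driving function at some time `s < b` (`IsSolution.exists_norm_sub_lt`),
and `yₜ ≤ yₛ ≤ |zₛ| < ε` afterwards. Rohde–Schramm (2005), p. 904 ("`τ(ẑ)` is a.s. the time at
which `u` hits `-∞`"). [cite: RohdeSchramm2005, Lemma 6.3 (proof)] -/
theorem imFlowStop_lt_of_near_swallowingTime (hW : Continuous W) (hz : 0 < z.im) {b : ℝ≥0}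
    (hb : swallowingTime W z = b) {ε : ℝ} (hε : 0 < ε) :
    ∃ s : ℝ≥0, s < b ∧ ∀ t : ℝ≥0, s ≤ t → t < b → imFlowStop W z t < ε := by
  have hz0 : z ≠ W 0 := by
    intro h; rw [h, ofReal_im] at hz; exact lt_irrefl _ hz
  have hb0 : 0 < b := by
    have := swallowingTime_pos_holds hW hz0
    rwa [hb, WithTop.coe_pos] at this
  obtain ⟨g, hg⟩ := exists_isSolution_swallowingTime_holds hW hz0
  rw [hb] at hg
  obtain ⟨s, hs0, hsb, hlt⟩ := hg.exists_norm_sub_lt hW hb0 hb hε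
  have hsb' : s.toNNReal < b := (Real.toNNReal_lt_iff_lt_coe hs0).2 hsb
  refine ⟨s.toNNReal, hsb', fun t hst htb ↦ ?_⟩
  have hsT : ((s.toNNReal : ℝ≥0) : WithTop ℝ≥0) < swallowingTime W z := by
    rw [hb]; exact_mod_cast hsb'
  have hsT' : ((s.toNNReal : ℝ≥0) : WithTop ℝ≥0) < (b : WithTop ℝ≥0) := by exact_mod_cast hsb'
  calc imFlowStop W z t ≤ imFlowStop W z s.toNNReal := imFlowStop_antitone hW hz hst
    _ ≤ ‖map W s.toNNReal z - W s.toNNReal‖ := imFlowStop_le_norm_sub hsT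
    _ = ‖g s - W s.toNNReal‖ := by rw [map_eq_of_isSolution hW hg hsT', Real.coe_toNNReal _ hs0]
    _ < ε := hlt

/-- **The frozen imaginary part is a continuous path** (`W` continuous, `im z > 0`): continuous
before `T_z` (`continuousOn_map_left`), identically `0` after, and `y_{T_z-} = 0`
(`imFlowStop_lt_of_near_swallowingTime`). [folklore] -/
theorem continuous_imFlowStop (hW : Continuous W) (hz : 0 < z.im) : Continuous (imFlowStop W z) := by
  have hz0 : z ≠ W 0 := by
    intro h; rw [h, ofReal_im] at hz; exact lt_irrefl _ hz
  set T := swallowingTime W z with hTdef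
  have hopen : IsOpen {s : ℝ≥0 | (s : WithTop ℝ≥0) < T} := by
    induction T using WithTop.recTopCoe with
    | top =>
      have : {s : ℝ≥0 | (s : WithTop ℝ≥0) < ⊤} = univ :=
        eq_univ_of_forall fun s ↦ WithTop.coe_lt_top s
      rw [this]; exact isOpen_univ
    | coe b => simp only [WithTop.coe_lt_coe]; exact isOpen_Iio
  have hU : ContinuousOn (imFlowStop W z) {s | (s : WithTop ℝ≥0) < T} :=
    (continuous_im.comp_continuousOn (continuousOn_map_left hW hz0)).congr
      fun s hs ↦ imFlowStop_of_lt hs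
  rw [continuous_iff_continuousAt]
  intro t
  by_cases ht : (t : WithTop ℝ≥0) < T
  · exact hU.continuousAt (hopen.mem_nhds ht)
  rw [not_lt] at ht
  obtain ⟨b, hb⟩ := WithTop.ne_top_iff_exists.1 (ne_top_of_le_ne_top WithTop.coe_ne_top ht)
  have hbt : b ≤ t := by rw [← hb] at ht; exact_mod_cast ht
  have hzero : ∀ s : ℝ≥0, b ≤ s → imFlowStop W z s = 0 := fun s hs ↦
    imFlowStop_of_not_lt (by rw [← hTdef, ← hb, not_lt]; exact_mod_cast hs)
  rcases hbt.lt_or_eq with hbt | hbt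
  · -- strictly after `T_z`: locally constant
    have hev : ∀ᶠ s in 𝓝 t, imFlowStop W z s = 0 := by
      filter_upwards [Ioi_mem_nhds hbt] with s hs
      exact hzero s hs.le
    exact (continuousAt_const (y := (0 : ℝ))).congr (hev.mono fun s hs ↦ hs.symm)
  subst hbt
  rw [continuousAt_iff_continuous_left'_right']
  refine ⟨?_, (continuousWithinAt_const (b := (0 : ℝ))).congr (fun s hs ↦ hzero s (le_of_lt hs))
    (hzero b le_rfl)⟩
  rw [ContinuousWithinAt, hzero b le_rfl, Metric.tendsto_nhdsWithin_nhds]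
  intro ε hε
  obtain ⟨s₀, hs₀b, hs₀⟩ := imFlowStop_lt_of_near_swallowingTime hW hz hb.symm hε
  refine ⟨(b : ℝ) - s₀, sub_pos.2 (NNReal.coe_lt_coe.2 hs₀b), fun s hs hdist ↦ ?_⟩
  have hsb : s < b := hs
  rw [NNReal.dist_eq, abs_sub_comm, abs_of_nonneg (sub_nonneg.2 (NNReal.coe_le_coe.2 hsb.le))]
    at hdist
  have hs₀s : s₀ ≤ s := NNReal.coe_le_coe.1 (by linarith)
  rw [Real.dist_eq, sub_zero, abs_of_nonneg (imFlowStop_nonneg hW hz s)]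
  exact hs₀ s hs₀s hsb

end Loewner

end Literature.Probability.RandomPlanarGeometry
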